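import Literature.AnabelianGeometry.EtaleTheta.LogDivisorModelTateTowerKummerTwistTower
import Literature.AnabelianGeometry.EtaleTheta.LogDivisorModelTateTowerKummerRootLaw

/-!
# [EtTh] Def. 3.3 (iii) v2 / ERRATUM E2 (a): the ROOT LAW HOLDS on the ζ-twisted Kummer–Tate tower — roots of the
# ROOTS OF UNITY are found at deeper levels, compatibly with the non-abelian Galois action

S. Mochizuki, *The étale theta function …*, Publ. RIMS **45** (2009) [MochizukiEtTh2009], §3 Def. 3.3 (iii) pp.73–74, Prop.
3.2 (iii) p.70; ERRATUM E2 = [IUTchI] Rmk. 3.2.4 (i)(a) («for every `N ∈ ℕ_{≥1}`, `f` admits an `N`-th root over some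
tempered covering») [cite: MochizukiEtTh2009, Def 3.3 (iii) p.73].

CLASS (b) MODEL, PROOF-ONLY sequel (abc-iut cell, layer L2; L2-lead R722 «piece (d) — tower laws / RootLaw / isTempered»;
seat abc-iut-L2-d2 gen 6) to `LogDivisorModelTateTowerKummerTwistTower.lean` (`towerC : LogDivisorTower Compat levelsC`);
consumed BY NAME: abc-iut-L1-t6's `compat` / `closureC` / `lvlC` / `natElt` / `natCast_factorial_eq_zero_iff` /
`toAdd_left_mul` / `toAdd_left_inv` / `continuous_coordK/C` (p471292, p472997), abc-iut-L2-t3's `rootLaw_ofTower_iff`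
(p456136), abc-iut-w6-d058's `TateTowerKummer.dvd_e_add` and the quotient-covering pattern of
`LogDivisorModelTateTowerKummerRootLaw.lean` (there `Grp` is COMMUTATIVE: every stabiliser of `Grp/H` is `H`; here the
group is non-abelian and the three new points are (1) conjugate stabilisers, (2) countability of `Compat/H` by an
INJECTION into (orbit × finitely many Kummer coordinates × a function value), (3) the root of a ROOT OF UNITY).
* §1 open subgroups of `Compat`: stabilisers `stabC`, Kummer levels `kumLevelC m` (both index-`< m` coordinates vanish;
  `natElt_mem_kumLevelC_iff`), and the stabiliser `fnStabC m x` of a level-`m` function under the level-`m` action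
  (open: the action factors through the discrete index-`m` coordinates, `rho_congr`).
* §2 `quotCoverC H` — `Compat/H` as a connected tempered covering for `H` open of countable index (stabiliser of `gH` =
  `gHg⁻¹`); **`le_lvlC_quotCoverC`**: `H ⊆ kumLevelC m ⇒ m ≤ lvlC (Compat/H)` (witness `natElt`).
* §3 **`TateTowerKummerTwist.rootLawC : (DivisorMonoids.ofTower towerC).RootLaw`** — E2 (a) HOLDS: for `b ∈ B₀(Y)` at level
  `n = lvlC Y`, `N ≥ 1`, put `m := n + N`, `e := eN n m = N·q` (`dvd_e_add`); the value `b(y₀) = (ζ, ϖ_n^c U_n^k)` has the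
  level-`m` `N`-th root `r₀ := (ζ_{N m}^{q·ζ̃}, ϖ_m^{qc} U_m^{qk})` (`ζ̃ ∈ ℕ` a lift of `ζ` — the root of a root of unity
  needs the modulus to GROW: `N_m = e·N_n`); over the cover `Y′ := Compat/(Stab(y₀) ∩ kumLevelC m ∩ fnStabC m r₀)` (level
  `l′ ≥ m`) the family `[g] ↦ g ·_{l′} resFnC r₀` is a well-defined element of `B₀(Y′)` (abc-iut-w6-d048's
  `exists_bZero_quotient_of_invariant`) and is an `N`-th root of `b` pulled back and moved to level `l′` — by the
  EQUIVARIANCE of the transitions on `compat` (`resFnC_actFnHom`).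
HONEST FRAMING: a combinatorial consistency witness for OUR typed v2 interface (class-(b) design model, not the tempered
tower of a Tate curve); nothing here bears on [IUTchIII] Cor. 3.12; no side taken; typed ≠ proved.
-/

noncomputable section

namespace Literature.AnabelianGeometry.EtaleTheta

open CategoryTheory Opposite Function Literature.AlgebraicGeometry.Frobenioids
  Literature.AlgebraicGeometry.Frobenioids.QuasiTemperoid Literature.AnabelianGeometry.SemiGraphs LogDivisorTower

namespace TateTowerKummerTwist

open LogDivisorModel LogDivisorModel.TateTowerTwist

/-! ## §1 Open subgroups of the compatible group -/

/-- The stabiliser of a point of a tempered `Compat`-set (an open subgroup). [cite: MochizukiSemiAnbd2006, §3 p.33] -/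
def stabC (T : BTemp Compat) (y : T.obj.V) : Subgroup Compat where
  carrier := {g | T.obj.ρ g y = y}
  mul_mem' {a b} ha hb := by
    change T.obj.ρ (a * b) y = y
    rw [BTempConnected.ρ_mul_apply, hb, ha]
  one_mem' := BTempConnected.ρ_one_apply T y
  inv_mem' {a} ha := by
    change T.obj.ρ a⁻¹ y = y
    conv_lhs => rw [← ha]
    exact BTempConnected.ρ_inv_apply T a y

/-- Stabilisers are open. [cite: MochizukiSemiAnbd2006, §3 p.33] -/
theorem isOpen_stabC (T : BTemp Compat) (y : T.obj.V) : IsOpen (stabC T y : Set Compat) := T.property.2 y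

/-- `kumLevelC m`: BOTH Kummer coordinates of every index `< m` vanish (no condition on `c`, `γ`).
[cite: MochizukiEtTh2009, Def 3.3 (ii) p.73] -/
def kumLevelC (m : ℕ) : Subgroup Compat where
  carrier := {g | ∀ i < m, (g : Grp).1.left.toAdd i = 0}
  mul_mem' {a b} ha hb i hi := by rw [Subgroup.coe_mul, toAdd_left_mul, ha i hi, hb i hi, smul_zero, add_zero]
  one_mem' i _ := by rw [Subgroup.coe_one, Prod.fst_one, SemidirectProduct.one_left, toAdd_one, Pi.zero_apply]
  inv_mem' {a} ha i hi := by rw [Subgroup.coe_inv, toAdd_left_inv, ha i hi, neg_zero, smul_zero]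

/-- `Δ_m ∩ compat ⊆ kumLevelC m`. [cite: MochizukiEtTh2009, Def 3.3 (ii) p.73] -/
theorem closureC_le_kumLevelC (m : ℕ) : closureC m ≤ kumLevelC m := fun g hg =>
  ((mem_closure_iff m (g : Grp)).1 ((mem_closureC_iff m g).1 hg)).2.2

/-- `kumLevelC m` is open (finitely many discrete coordinates are constrained). [cite: MochizukiEtTh2009, Def 3.3 (ii) p.73] -/
theorem isOpen_kumLevelC (m : ℕ) : IsOpen (kumLevelC m : Set Compat) := by
  have h : (kumLevelC m : Set Compat) =
      ⋂ i ∈ Finset.range m, (fun g : Compat => (g : Grp).1.left.toAdd i) ⁻¹' {0} := by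
    ext g
    simp only [Set.mem_iInter, Set.mem_preimage, Set.mem_singleton_iff, Finset.mem_range]
    rfl
  rw [h]
  exact isOpen_biInter_finset fun i _ =>
    (isOpen_discrete _).preimage ((continuous_coordK i).comp continuous_subtype_val)

/-- abc-iut-L1-t6's integer `(j+1)!` lies in `kumLevelC m` iff `m ≤ j`. [cite: MochizukiEtTh2009, Def 3.3 (ii) p.73] -/
theorem natElt_mem_kumLevelC_iff (j m : ℕ) : natElt j ∈ kumLevelC m ↔ m ≤ j := by
  have hc : ∀ i, ((natElt j : Grp)).1.left.toAdd i = ((((j + 1).factorial : ℕ) : ZMod (M i)), 0) := fun i => by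
    change (ofKum _).1.left.toAdd i = _
    rw [ofKum, SemidirectProduct.left_inl, toAdd_ofAdd]
  constructor
  · intro h
    by_contra hm
    have h1 := h j (lt_of_not_ge hm)
    rw [hc, Prod.mk_eq_zero, natCast_factorial_eq_zero_iff] at h1
    exact lt_irrefl j h1.1
  · intro h i hi
    rw [hc, Prod.mk_eq_zero, natCast_factorial_eq_zero_iff]
    exact ⟨lt_of_lt_of_le hi h, rfl⟩

/-- `rho m g` depends only on the index-`m` coordinates of `g` (and the translation). [cite: MochizukiEtTh2009, Def 3.3 (ii) p.73] -/
theorem rho_congr {m : ℕ} {g g' : Grp} (hk : g.1.left.toAdd m = g'.1.left.toAdd m)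
    (hc : g.1.right m = g'.1.right m) (h2 : g.2 = g'.2) : rho m g = rho m g' := by
  refine Prod.ext (SemidirectProduct.ext (Multiplicative.toAdd.injective ?_) (MulEquiv.ext fun ζ =>
    Multiplicative.toAdd.injective ?_)) h2
  · rw [rho_left, rho_left, toAdd_kumN, toAdd_kumN, hk]
  · rw [rho_right, rho_right, toAdd_chiN, toAdd_chiN, hc]

/-- The stabiliser of a function `x` of level `m` under the level-`m` action of `Compat`.
[cite: MochizukiEtTh2009, Def 3.3 (iii) p.73] -/
def fnStabC (m : ℕ) (x : Fn (MuN m)) : Subgroup Compat where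
  carrier := {g | actFnHom (rho m (g : Grp)) x = x}
  mul_mem' {a b} ha hb := by
    change actFnHom (rho m ((a * b : Compat) : Grp)) x = x
    rw [Subgroup.coe_mul, map_mul, map_mul, MulAut.mul_apply, hb, ha]
  one_mem' := by
    change actFnHom (rho m ((1 : Compat) : Grp)) x = x
    rw [Subgroup.coe_one, map_one, map_one, MulAut.one_apply]
  inv_mem' {a} ha := by
    change actFnHom (rho m ((a⁻¹ : Compat) : Grp)) x = x
    rw [Subgroup.coe_inv, map_inv, map_inv, MulAut.inv_apply]
    exact (MulEquiv.symm_apply_eq _).2 ha.symm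

/-- `fnStabC m x` is open: it contains, with `g₀`, every `g` with the same index-`m` coordinates (`rho_congr`), an open set.
[cite: MochizukiEtTh2009, Def 3.3 (iii) p.73] -/
theorem isOpen_fnStabC (m : ℕ) (x : Fn (MuN m)) : IsOpen (fnStabC m x : Set Compat) := by
  -- the index-`m` coordinates (and the translation), valued in a discrete space
  let F : Compat → (ZMod (M m) × ZMod (M m)) × ZMod (M m) × Multiplicative ℤ :=
    fun g => ((g : Grp).1.left.toAdd m, ((g : Grp).1.right m : ZMod (M m)), (g : Grp).2)
  have hF : Continuous F :=
    ((continuous_coordK m).comp continuous_subtype_val).prodMk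
      ((Units.continuous_val.comp ((continuous_coordC m).comp continuous_subtype_val)).prodMk
        (continuous_snd.comp continuous_subtype_val))
  refine isOpen_iff_forall_mem_open.2 fun g₀ hg₀ => ⟨F ⁻¹' {F g₀}, fun g hg => ?_, (isOpen_discrete _).preimage hF, rfl⟩
  obtain ⟨hk, hc2⟩ := Prod.ext_iff.1 (Set.mem_singleton_iff.1 hg)
  obtain ⟨hc, h2⟩ := Prod.ext_iff.1 hc2
  change actFnHom (rho m (g : Grp)) x = x
  rw [rho_congr hk (Units.ext hc) h2]
  exact hg₀

/-! ## §2 Quotient coverings of the non-abelian compatible group and their levels -/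

/-- Stabilisers in `Compat/H`: `k` fixes `gH` iff `g⁻¹ k g ∈ H`. [cite: MochizukiFrdII2008, Ex 1.3 (ii) p.11] -/
theorem ofMulAction_quot_fix_iff (H : Subgroup Compat) (g k : Compat) :
    (Action.ofMulAction Compat (Compat ⧸ H)).ρ k (g : Compat ⧸ H) = (g : Compat ⧸ H) ↔ g⁻¹ * k * g ∈ H := by
  rw [Action.ofMulAction_apply, MulAction.Quotient.smul_coe, smul_eq_mul]
  change ((k * g : Compat) : Compat ⧸ H) = (g : Compat ⧸ H) ↔ _
  rw [QuotientGroup.eq, ← inv_mem_iff, mul_inv_rev, inv_inv, ← mul_assoc]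

/-- **The connected tempered covering `Compat/H`** for an open subgroup `H` of countable index (stabilisers are the
conjugates `gHg⁻¹`, open; one orbit). [cite: MochizukiFrdII2008, Ex 1.3 (ii) p.11] -/
def quotCoverC (H : Subgroup Compat) (hH : IsOpen (H : Set Compat)) (hc : Countable (Compat ⧸ H)) :
    ConnectedPart (BTemp Compat) :=
  ⟨⟨Action.ofMulAction Compat (Compat ⧸ H), hc, fun q => by
      induction q using QuotientGroup.induction_on with
      | H g =>
        have h : {k : Compat | (Action.ofMulAction Compat (Compat ⧸ H)).ρ k (g : Compat ⧸ H) = (g : Compat ⧸ H)} =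
            (fun k : Compat => g⁻¹ * k * g) ⁻¹' (H : Set Compat) := Set.ext fun k => ofMulAction_quot_fix_iff H g k
        rw [h]
        exact hH.preimage ((continuous_const.mul continuous_id).mul continuous_const)⟩,
    BTempConnected.isConnectedObj_of_transitive _ ((1 : Compat) : Compat ⧸ H) fun q => by
      induction q using QuotientGroup.induction_on with
      | H g => exact ⟨g, by rw [Action.ofMulAction_apply, MulAction.Quotient.smul_coe, smul_eq_mul, mul_one]⟩⟩

/-- If `Δ_l ∩ compat` fixes `Compat/H` then `Δ_l ∩ compat ⊆ H`. [cite: MochizukiEtTh2009, Def 3.3 (i) p.72] -/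
theorem closureC_le_of_fixes (H : Subgroup Compat) (hH : IsOpen (H : Set Compat)) (hc : Countable (Compat ⧸ H)) (l : ℕ)
    (h : ∀ g ∈ closureC l, ∀ y : (quotCoverC H hH hc).obj.obj.V, (quotCoverC H hH hc).obj.obj.ρ g y = y) :
    closureC l ≤ H := fun g hg => by
  have h1 := (ofMulAction_quot_fix_iff H 1 g).1 (h g hg ((1 : Compat) : Compat ⧸ H))
  rwa [inv_one, one_mul, mul_one] at h1

/-- **Level lower bound**: if `H ⊆ kumLevelC m` then `m ≤ lvlC (Compat/H)` (the integer `(l+1)!` of abc-iut-L1-t6 lies in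
`Δ_l` but not in `kumLevelC m` for `l < m`). [cite: MochizukiEtTh2009, Def 3.3 (ii) p.73] -/
theorem le_lvlC_quotCoverC (H : Subgroup Compat) (hH : IsOpen (H : Set Compat)) (hc : Countable (Compat ⧸ H)) {m : ℕ}
    (hm : H ≤ kumLevelC m) : m ≤ lvlC (quotCoverC H hH hc) := by
  have h := closureC_le_of_fixes H hH hc _ (closureC_lvlC_fixes (quotCoverC H hH hc))
  exact (natElt_mem_kumLevelC_iff _ m).1 (hm (h ((natElt_mem_closureC_iff _ _).2 le_rfl)))

/-- **Countability of `Compat/(Stab(y₀) ∩ kumLevelC m ∩ fnStabC m r₀)`**: the coset of `g` is determined by `g·y₀`, the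
Kummer coordinates of `g` of index `< m`, and `g · r₀` (an injection into a countable set).
[cite: MochizukiSemiAnbd2006, §3 p.33] -/
theorem countable_quot (Y : ConnectedPart (BTemp Compat)) (y₀ : Y.obj.obj.V) (m : ℕ) (r₀ : Fn (MuN m)) :
    Countable (Compat ⧸ (stabC Y.obj y₀ ⊓ kumLevelC m ⊓ fnStabC m r₀)) := by
  haveI : Countable Y.obj.obj.V := Y.obj.property.1
  haveI : ∀ i : Fin m, NeZero (M (i : ℕ)) := fun i => ⟨(Nat.factorial_pos _).ne'⟩
  haveI : Countable (Fn (MuN m)) :=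
    Countable.of_equiv (ZMod (N m) × (ℤ × ℤ)) (Multiplicative.ofAdd.prodCongr Multiplicative.ofAdd)
  let H := stabC Y.obj y₀ ⊓ kumLevelC m ⊓ fnStabC m r₀
  let F : Compat → Y.obj.obj.V × (∀ i : Fin m, ZMod (M i) × ZMod (M i)) × Fn (MuN m) :=
    fun g => (Y.obj.obj.ρ g y₀, fun i => (g : Grp).1.left.toAdd i, actFnHom (rho m (g : Grp)) r₀)
  have hF : ∀ a b : Compat, a⁻¹ * b ∈ H → F a = F b := by
    intro a b hab
    obtain ⟨⟨h1, h2⟩, h3⟩ := hab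
    have hb : b = a * (a⁻¹ * b) := by rw [mul_inv_cancel_left]
    refine Prod.ext ?_ (Prod.ext (funext fun i => ?_) ?_)
    · change Y.obj.obj.ρ a y₀ = Y.obj.obj.ρ b y₀
      rw [hb, BTempConnected.ρ_mul_apply]
      exact (congrArg _ h1).symm
    · change (a : Grp).1.left.toAdd i = (b : Grp).1.left.toAdd i
      rw [hb, Subgroup.coe_mul, toAdd_left_mul, h2 i i.2, smul_zero, add_zero]
    · change actFnHom (rho m (a : Grp)) r₀ = actFnHom (rho m (b : Grp)) r₀
      have h3' : actFnHom (rho m ((a⁻¹ * b : Compat) : Grp)) r₀ = r₀ := h3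
      rw [hb, Subgroup.coe_mul, map_mul, map_mul, MulAut.mul_apply, h3']
  refine Function.Injective.countable (f := fun q : Compat ⧸ H => Quotient.liftOn' q F fun a b hab =>
    hF a b (QuotientGroup.leftRel_apply.1 hab)) fun q₁ q₂ hq => ?_
  induction q₁ using QuotientGroup.induction_on with
  | H a =>
    induction q₂ using QuotientGroup.induction_on with
    | H b =>
      change F a = F b at hq
      obtain ⟨h1, h23⟩ := Prod.ext_iff.1 hq
      obtain ⟨h2, h3⟩ := Prod.ext_iff.1 h23
      refine QuotientGroup.eq.2 ⟨⟨?_, fun i hi => ?_⟩, ?_⟩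
      · change Y.obj.obj.ρ (a⁻¹ * b) y₀ = y₀
        rw [BTempConnected.ρ_mul_apply]
        exact (congrArg _ h1.symm).trans (BTempConnected.ρ_inv_apply Y.obj a y₀)
      · have h2i := congrFun h2 ⟨i, hi⟩
        change (a : Grp).1.left.toAdd i = (b : Grp).1.left.toAdd i at h2i
        rw [Subgroup.coe_mul, Subgroup.coe_inv, toAdd_left_mul, toAdd_left_inv, Prod.fst_inv,
          SemidirectProduct.inv_right, Pi.inv_apply, ← h2i, ← smul_add, neg_add_cancel, smul_zero]
      · change actFnHom (rho m ((a⁻¹ * b : Compat) : Grp)) r₀ = r₀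
        have h3' : actFnHom (rho m (a : Grp)) r₀ = actFnHom (rho m (b : Grp)) r₀ := h3
        rw [Subgroup.coe_mul, Subgroup.coe_inv, map_mul, map_mul, MulAut.mul_apply, ← h3', map_inv, map_inv,
          MulAut.inv_apply_self]

/-! ## §3 E2 (a): the root law on the ζ-twisted tower -/

/-- Transitions compose (`resFnC` version of the tower field). [cite: MochizukiEtTh2009, Def 3.3 (iii) p.73] -/
theorem resFnC_trans {i j k : ℕ} (hij : i ≤ j) (hjk : j ≤ k) (f : Fn (MuN i)) :
    resFnC hjk (resFnC hij f) = resFnC (hij.trans hjk) f := by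
  refine Prod.ext (Multiplicative.toAdd.injective ?_) ?_
  · change upAdd hjk (upAdd hij (Multiplicative.toAdd f.1)) = upAdd (hij.trans hjk) (Multiplicative.toAdd f.1)
    exact upAdd_trans hij hjk _
  · change (f.2 ^ eN i j) ^ eN j k = f.2 ^ eN i k
    rw [← pow_mul, eN_mul_eN hij hjk]

/-- `eN n (n + N) = N · q`: the ramification index from level `n` to level `n + N` is divisible by `N`
(abc-iut-w6-d058's `dvd_e_add`). [cite: MochizukiEtTh2009, Def 3.3 (iii) p.73] -/
theorem dvd_eN_add (n : ℕ) (K : ℕ+) : (K : ℕ) ∣ eN n (n + K) := by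
  have h := TateTowerKummer.dvd_e_add (n + 1) K
  rwa [Nat.add_right_comm] at h

/-- **The level-`m` root of a level-`n` value** (`m = n + N`, `eN n m = N·q`): `(ζ, ϖ_n^c U_n^k) ↦ (ζ_{N m}^{q ζ̃}, ϖ_m^{qc}
U_m^{qk})` with `ζ̃ ∈ ℕ` a lift of `ζ ∈ ℤ/N_n` — its `N`-th power is the transition of the value to level `m` (the root of the
ROOT OF UNITY exists because the modulus grows by the factor `e`). [cite: MochizukiEtTh2009, Def 3.3 (iii) p.73] -/
theorem root_pow_eq_resFnC {n m : ℕ} (hnm : n ≤ m) {K q : ℕ} (hq : eN n m = K * q) (x : Fn (MuN n)) :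
    ((Multiplicative.ofAdd ((((q * (Multiplicative.toAdd x.1).val : ℕ)) : ZMod (N m))), x.2 ^ q) : Fn (MuN m)) ^ K =
      resFnC hnm x := by
  refine Prod.ext (Multiplicative.toAdd.injective ?_) ?_
  · change K • (((q * (Multiplicative.toAdd x.1).val : ℕ)) : ZMod (N m)) = upAdd hnm (Multiplicative.toAdd x.1)
    conv_rhs => rw [← ZMod.natCast_zmod_val (Multiplicative.toAdd x.1), ← Int.cast_natCast, upAdd_intCast,
      Int.cast_natCast, ← Nat.cast_mul]
    rw [nsmul_eq_mul, ← Nat.cast_mul, ← mul_assoc, ← hq, Nat.mul_comm]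
  · change (x.2 ^ q) ^ K = x.2 ^ eN n m
    rw [← pow_mul, mul_comm, ← hq]

/-- **E2 (a) — the ROOT LAW — HOLDS on the ζ-twisted Kummer–Tate tower**: every `b ∈ B₀(Y)` (level `n = lvlC Y`)
acquires, for every `N ≥ 1`, an `N`-th root over the connected tempered covering
`Y′ = Compat/(Stab(y₀) ∩ kumLevelC (n+N) ∩ fnStabC (n+N) r₀)` at the level `l′ ≥ n + N` of `Y′`: the family
`[g] ↦ g ·_{l′} resFnC r₀` — well defined, equivariant, and an `N`-th root of `b` pulled back to `Y′` and moved to level `l′`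
because the transitions are EQUIVARIANT on `compat`. [cite: MochizukiEtTh2009, Def 3.3 (iii) p.73] -/
theorem rootLawC : (DivisorMonoids.ofTower towerC).RootLaw := by
  rw [LogDivisorTower.rootLaw_ofTower_iff]
  intro K Y b
  obtain ⟨y₀⟩ := BTempConnected.nonempty_of_isConnectedObj Y.obj Y.property
  -- the level `n` of `Y`, the target level `m = n + K`, `eN n m = K q`
  obtain ⟨q, hq⟩ := dvd_eN_add (lvlC Y) K
  have hnm : lvlC Y ≤ lvlC Y + K := Nat.le_add_right _ _
  -- the value at `y₀` and its level-`m` `K`-th root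
  let x₀ : Fn (MuN (lvlC Y)) := b.1 y₀
  let r₀ : Fn (MuN (lvlC Y + K)) :=
    (Multiplicative.ofAdd (((q * (Multiplicative.toAdd x₀.1).val : ℕ) : ZMod (N (lvlC Y + K)))), x₀.2 ^ q)
  have hr₀ : r₀ ^ (K : ℕ) = resFnC hnm x₀ := root_pow_eq_resFnC hnm hq x₀
  -- the cover `Y′`
  let H : Subgroup Compat := stabC Y.obj y₀ ⊓ kumLevelC (lvlC Y + K) ⊓ fnStabC (lvlC Y + K) r₀
  have hH : IsOpen (H : Set Compat) :=
    ((isOpen_stabC Y.obj y₀).inter (isOpen_kumLevelC _)).inter (isOpen_fnStabC _ r₀)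
  let Y' : ConnectedPart (BTemp Compat) := quotCoverC H hH (countable_quot Y y₀ _ r₀)
  -- the covering map `Y′ → Y`, `[g] ↦ g · y₀`
  obtain ⟨f₀, hf₀⟩ := BTempConnected.exists_hom_of_stabilizer_le (T₁ := Y'.obj) (T₂ := Y.obj)
    ((1 : Compat) : Compat ⧸ H)
    (fun q => by
      induction q using QuotientGroup.induction_on with
      | H g => exact ⟨g, by
          change (Action.ofMulAction Compat (Compat ⧸ H)).ρ g _ = _
          rw [Action.ofMulAction_apply, MulAction.Quotient.smul_coe, smul_eq_mul, mul_one]⟩)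
    y₀ (fun g hg => by
      have h1 := (ofMulAction_quot_fix_iff H 1 g).1 hg
      rw [inv_one, one_mul, mul_one] at h1
      exact h1.1.1)
  let f : Y' ⟶ Y := ObjectProperty.homMk f₀
  -- the level of `Y′` is at least `m`
  have hml : lvlC Y + K ≤ lvlC Y' :=
    le_lvlC_quotCoverC H hH _ (fun g hg => hg.1.2)
  have hnl : lvlC Y ≤ lvlC Y' := hnm.trans hml
  -- the root at level `l′ = lvlC Y′`, as an equivariant family on `Compat/H`
  obtain ⟨r, hr⟩ := (actC (lvlC Y')).exists_bZero_quotient_of_invariant H (f := resFnC hml r₀) trivial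
    (fun h hh => by
      change actFnHom (rho (lvlC Y') (h : Grp)) (resFnC hml r₀) = resFnC hml r₀
      rw [← resFnC_actFnHom hml h r₀]
      exact congrArg (resFnC hml) hh.2)
  refine ⟨Y', f, r, Subtype.ext (funext fun s => ?_)⟩
  induction s using QuotientGroup.induction_on with
  | H g =>
    -- `[g] = g · [1]`, hence `f [g] = g · y₀`, `r [g] = g ·_{l′} resFnC r₀`, and `b (g · y₀) = g ·_n b y₀`
    have e1 : (g : Compat ⧸ H) = (Action.ofMulAction Compat (Compat ⧸ H)).ρ g ((1 : Compat) : Compat ⧸ H) := by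
      rw [Action.ofMulAction_apply, MulAction.Quotient.smul_coe, smul_eq_mul, mul_one]
    have hfg : f.hom.hom.hom (g : Compat ⧸ H) = Y.obj.obj.ρ g y₀ := by
      have h := BTempConnected.hom_ρ f₀ g ((1 : Compat) : Compat ⧸ H)
      rw [hf₀] at h
      exact (congrArg _ e1).trans h
    have hrg : r.1 (g : Compat ⧸ H) = actFnHom (rho (lvlC Y') (g : Grp)) (resFnC hml r₀) := by
      have h := r.2.2 g ((1 : Compat) : Compat ⧸ H)
      rw [hr] at h
      exact (congrArg r.1 e1).trans h
    have hbg : b.1 (Y.obj.obj.ρ g y₀) = actFnHom (rho (lvlC Y) (g : Grp)) x₀ := b.2.2 g y₀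
    change r.1 (g : Compat ⧸ H) ^ (K : ℕ) = resFnC hnl (b.1 (f.hom.hom.hom (g : Compat ⧸ H)))
    rw [hrg, hfg, hbg]
    change (actFnHom (rho (lvlC Y') (g : Grp)) (resFnC hml r₀) : Fn (MuN (lvlC Y'))) ^ (K : ℕ) =
      resFnC hnl (actFnHom (rho (lvlC Y) (g : Grp)) x₀)
    rw [← map_pow, ← map_pow, hr₀, resFnC_trans hnm hml, resFnC_actFnHom hnl g x₀]

/-- **E2 (a) and NON-DEGENERACY coexist on the ζ-twisted tower** (with the content of the tower file: the constant field
MOVES and the Kummer part TWISTS): the root law, a constant of level `2` moved by `conjC`, and `U_1 ↦ ζ_2·U_1 ≠ U_1`.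
[cite: MochizukiEtTh2009, Def 3.3 (iii) p.73] -/
theorem rootLawC_and_nonvacuous :
    (DivisorMonoids.ofTower towerC).RootLaw ∧
      (∃ f ∈ (model (MuN 2)).const, (actC 2).actFn conjC f ≠ f) ∧
        (actC 1).actFn kumOneC (coordU (MuN 1)) ≠ coordU (MuN 1) :=
  ⟨rootLawC, exists_const_ne_conjC le_rfl, actFn_kumOneC_coordU_ne le_rfl⟩

end TateTowerKummerTwist

end Literature.AnabelianGeometry.EtaleTheta

end
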